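import Summits.AtomisticToContinuum.HydrodynamicLimit.Theorems.OneFlightGossipEngineCollisionActivityTailsEndpointTails
import HarnessLib

/-!
# `TransferActivityTails` (stmt-AtomisticToContinuum-16624), line `IdeatorOneSketch`: stub `stub_meanTailAverage`

Averaging of per-sphere bounds: if each of `N + 1` nonnegative a.e.-measurable functions `g i` on configuration
space has `∫⁻ ofReal (g i) dμ ≤ B`, then so does their empirical average `(N+1)⁻¹ Σ_i g i`:
`∫⁻ ofReal ((N+1)⁻¹ Σ_i g_i) = ofReal ((N+1)⁻¹) · Σ_i ∫⁻ ofReal (g_i) ≤ ofReal ((N+1)⁻¹) · (N+1) · B = B`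
(`ENNReal.ofReal_mul`, `ENNReal.ofReal_sum_of_nonneg`, `lintegral_const_mul'`, `lintegral_finsetSum'`).
The general measure-space form is `lintegral_ofReal_average_le`; the registered statement `MeanTailAverage`
is its specialisation to `Cfg N`.
-/

noncomputable section

open MeasureTheory Set Filter Topology
open scoped ENNReal InnerProductSpace BigOperators

namespace Summit.AtomisticToContinuum.HydrodynamicLimit.Theorems.TransferActivityTailsMeanTailAverage

open Literature.MathematicalPhysics.KineticTheory Literature.Analysis.FluidPDE
open Summit.AtomisticToContinuum.HydrodynamicLimit.Theorems.CollisionActivityTailsEndpointTails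
  (Flow Cfg window tailFn tailFn_of_lt tailFn_of_le measurable_tailFn ae_mem_good_localGibbsLaw)

/-! ## The statement (verbatim from the line skeleton) -/

/-- Averaging of per-sphere bounds: if each of `N + 1` nonnegative a.e.-measurable functions has `∫ g_i dμ ≤ B`,
then so does their average `(N+1)⁻¹ Σ_i g_i` — registered stub signature of line IdeatorOneSketch, crux
TransferActivityTails (stmt-AtomisticToContinuum-16624) — route-internal, not a cited fact. -/
def MeanTailAverage : Prop :=
  ∀ (N : ℕ) (μ : Measure (Cfg N)) (g : Fin (N + 1) → Cfg N → ℝ) (B : ℝ≥0∞),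
    (∀ i, AEMeasurable (g i) μ) → (∀ i z, 0 ≤ g i z) → (∀ i, ∫⁻ z, ENNReal.ofReal (g i z) ∂μ ≤ B) →
    ∫⁻ z, ENNReal.ofReal (((N : ℝ) + 1)⁻¹ * ∑ i : Fin (N + 1), g i z) ∂μ ≤ B

/-! ## The proof -/

/-- General measure-space form of the averaging step: for `n + 1` nonnegative a.e.-measurable real functions
`g i` with `∫⁻ ofReal (g i) dμ ≤ B` the empirical average satisfies
`∫⁻ ofReal ((n+1)⁻¹ Σ_i g i) dμ ≤ B`.  Linearity of the lower Lebesgue integral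
(`lintegral_const_mul'`, `lintegral_finsetSum'`) after pushing `ofReal` through the nonnegative product and
sum, then `ofReal ((n+1)⁻¹) · ((n+1) · B) = B`. [folklore] -/
theorem lintegral_ofReal_average_le {Ω : Type*} [MeasurableSpace Ω] {μ : Measure Ω} {n : ℕ}
    (g : Fin (n + 1) → Ω → ℝ) (B : ℝ≥0∞) (hgm : ∀ i, AEMeasurable (g i) μ) (hg0 : ∀ i z, 0 ≤ g i z)
    (hgi : ∀ i, ∫⁻ z, ENNReal.ofReal (g i z) ∂μ ≤ B) :
    ∫⁻ z, ENNReal.ofReal (((n : ℝ) + 1)⁻¹ * ∑ i : Fin (n + 1), g i z) ∂μ ≤ B := by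
  have hn : (0 : ℝ) < (n : ℝ) + 1 := by positivity
  have hmeas : ∀ i, AEMeasurable (fun z => ENNReal.ofReal (g i z)) μ := fun i =>
    ENNReal.measurable_ofReal.comp_aemeasurable (hgm i)
  have hinv : ENNReal.ofReal (((n : ℝ) + 1)⁻¹) = ((n : ℝ≥0∞) + 1)⁻¹ := by
    rw [ENNReal.ofReal_inv_of_pos hn, ENNReal.ofReal_add (Nat.cast_nonneg _) zero_le_one,
      ENNReal.ofReal_natCast, ENNReal.ofReal_one]
  calc ∫⁻ z, ENNReal.ofReal (((n : ℝ) + 1)⁻¹ * ∑ i : Fin (n + 1), g i z) ∂μ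
      = ∫⁻ z, ENNReal.ofReal (((n : ℝ) + 1)⁻¹) * ∑ i : Fin (n + 1), ENNReal.ofReal (g i z) ∂μ := by
        refine lintegral_congr fun z => ?_
        rw [ENNReal.ofReal_mul (inv_nonneg.2 hn.le), ENNReal.ofReal_sum_of_nonneg fun i _ => hg0 i z]
    _ = ENNReal.ofReal (((n : ℝ) + 1)⁻¹) * ∑ i : Fin (n + 1), ∫⁻ z, ENNReal.ofReal (g i z) ∂μ := by
        rw [lintegral_const_mul' _ _ ENNReal.ofReal_ne_top, lintegral_finsetSum' _ fun i _ => hmeas i]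
    _ ≤ ENNReal.ofReal (((n : ℝ) + 1)⁻¹) * ∑ _i : Fin (n + 1), B :=
        mul_le_mul_right (Finset.sum_le_sum fun i _ => hgi i) _
    _ = B := by
        rw [Finset.sum_const, Finset.card_univ, Fintype.card_fin, nsmul_eq_mul, Nat.cast_add_one, hinv,
          ← mul_assoc, ENNReal.inv_mul_cancel (by simp) (by simp), one_mul]

/-- Stub 5 (registered): averaging of per-sphere bounds — the specialisation of
`lintegral_ofReal_average_le` to configuration space `Cfg N`. [folklore] -/
theorem stub_meanTailAverage : MeanTailAverage := by
  intro N μ g B hgm hg0 hgi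
  exact lintegral_ofReal_average_le g B hgm hg0 hgi

end Summit.AtomisticToContinuum.HydrodynamicLimit.Theorems.TransferActivityTailsMeanTailAverage

end
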